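import Summits.Ventures.DiscreteObjects.PP12.OrderThirteenReduction

/-!
# PP(12), order-13 cell: valid lift data BUILD a projective plane of order 12 with a collineation of order 13 (kernel; the converse)
Framing: lottery ticket; floor = certified bounds/negative ranges.

Cell pub-namedobj (venture DiscreteObjects), target (M), designs gen 16. Converse of `OrderThirteenReduction` (plane ⇒ valid `LiftData 11 13`):
from `D : LiftData 11 13` with `D.Valid` (`OrderThirteenCollineation`) we BUILD a Mathlib `Configuration.ProjectivePlane` of order 12 with a
collineation `shift` of order 13, so that the typed normal form is EXACT:
* points `TPt D` = the centre-like fixed point `ctr` (`P₀`), the 13 points `ax x` of the fixed line (`σ^x Q`), the 143 free points `fr t x`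
  (`σ^x P_t`); lines `TLn D` = the fixed line `axis` (`l₀`), the pencil `pen x` (`σ^x N`), the free lines `fl s y` (`σ^y L_s`); incidence
  `fr t x ∈ fl s y ↔ D.mem s t (x − y)`, `ax x ∈ fl s y ↔ x = y`, `ax x ∈ pen x' ↔ x = x'`, `fr t x ∈ pen x' ↔ x = x'`, `ctr ∈ pen x`, `ax x ∈ axis`;
* `D.Valid` says exactly that two distinct lines meet in exactly one point (`exists_meet`, `meet_unique`); with `|points| = |lines|`
  Mathlib's `HasPoints.hasLines` supplies the joins: **`liftPlane13 : ProjectivePlane (TPt D) (TLn D)`**, `order_liftPlane13 = 12`;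
* `shift` (`x ↦ x + 1`) is a collineation with `shift¹³ = 1`, `shift ≠ 1`;
* hence `noLiftData13_of_noOrderThirteen : NoOrderThirteenOrder12 → NoLiftData13` and, with `noOrderThirteen_of_noLiftData13`,
  **`noLiftData13_iff : NoLiftData13 ↔ NoOrderThirteenOrder12`** — the census statement of the order-13 cell IS the cell (as for `p = 2`,
  `LiftedPlane.noInvolutionOrder12_iff_noLiftable`, and the order-3 elation cell, `LiftedPlaneZp.noElationOrder3_iff_noLiftableSTD3`); an explicit
  valid `LiftData 11 13` would be a projective plane of order 12 (`exists_plane_of_liftData13`, the HIT route; none exists by the census, outside the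
  kernel). Nothing here asserts `NoLiftData13`. No `sorry`, no new axioms.
-/

namespace Summit.Ventures.DiscreteObjects.PP12

open Configuration Finset

namespace Lift13

/-- points of the plane built from lift data -/
inductive TPt (D : LiftData 11 13) : Type
  | ctr
  | ax (x : Fin 13)
  | fr (t : Fin 11) (x : Fin 13)
  deriving DecidableEq

/-- lines of the plane built from lift data -/
inductive TLn (D : LiftData 11 13) : Type
  | axis
  | pen (x : Fin 13)
  | fl (s : Fin 11) (y : Fin 13)
  deriving DecidableEq

variable {D : LiftData 11 13}

/-- incidence -/
def TPt.Inc : TPt D → TLn D → Prop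
  | .ctr, .axis => False
  | .ctr, .pen _ => True
  | .ctr, .fl _ _ => False
  | .ax _, .axis => True
  | .ax x, .pen x' => x = x'
  | .ax x, .fl _ y => x = y
  | .fr _ _, .axis => False
  | .fr _ x, .pen x' => x = x'
  | .fr t x, .fl s y => D.mem s t (x - y) = true

/-- incidence as membership -/
instance : Membership (TPt D) (TLn D) := ⟨fun m p => TPt.Inc p m⟩

/-- `ctr ∉ axis` -/
@[simp] theorem ctr_mem_axis : (TPt.ctr : TPt D) ∈ (TLn.axis : TLn D) ↔ False := Iff.rfl
/-- `ctr ∈ pen x` -/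
@[simp] theorem ctr_mem_pen {x : Fin 13} : (TPt.ctr : TPt D) ∈ (TLn.pen x : TLn D) ↔ True := Iff.rfl
/-- `ctr ∉ fl s y` -/
@[simp] theorem ctr_mem_fl {s : Fin 11} {y : Fin 13} : (TPt.ctr : TPt D) ∈ (TLn.fl s y : TLn D) ↔ False := Iff.rfl
/-- `ax x ∈ axis` -/
@[simp] theorem ax_mem_axis {x : Fin 13} : (TPt.ax x : TPt D) ∈ (TLn.axis : TLn D) ↔ True := Iff.rfl
/-- `ax x ∈ pen x' ↔ x = x'` -/
@[simp] theorem ax_mem_pen {x x' : Fin 13} : (TPt.ax x : TPt D) ∈ (TLn.pen x' : TLn D) ↔ x = x' := Iff.rfl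
/-- `ax x ∈ fl s y ↔ x = y` -/
@[simp] theorem ax_mem_fl {x : Fin 13} {s : Fin 11} {y : Fin 13} : (TPt.ax x : TPt D) ∈ (TLn.fl s y : TLn D) ↔ x = y := Iff.rfl
/-- `fr t x ∉ axis` -/
@[simp] theorem fr_mem_axis {t : Fin 11} {x : Fin 13} : (TPt.fr t x : TPt D) ∈ (TLn.axis : TLn D) ↔ False := Iff.rfl
/-- `fr t x ∈ pen x' ↔ x = x'` -/
@[simp] theorem fr_mem_pen {t : Fin 11} {x x' : Fin 13} : (TPt.fr t x : TPt D) ∈ (TLn.pen x' : TLn D) ↔ x = x' := Iff.rfl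
/-- `fr t x ∈ fl s y ↔ mem s t (x − y)` -/
@[simp] theorem fr_mem_fl {t : Fin 11} {x : Fin 13} {s : Fin 11} {y : Fin 13} :
    (TPt.fr t x : TPt D) ∈ (TLn.fl s y : TLn D) ↔ D.mem s t (x - y) = true := Iff.rfl

/-! ### Consequences of `Valid` -/

section Valid

/-- (M·U): `mem s t 0 = false` -/
theorem mem_zero (hD : D.Valid) (s t : Fin 11) : D.mem s t 0 = false := (hD.1 s).1.1 t

/-- (M·U): a non-zero residue lies in exactly one cell of row `s`; here: uniqueness for any residue -/
theorem mem_unique_t (hD : D.Valid) {s t t' : Fin 11} {z : Fin 13} (h : D.mem s t z = true) (h' : D.mem s t' z = true) : t = t' := by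
  by_cases hz : z = 0
  · subst hz; rw [mem_zero hD] at h; exact absurd h (by simp)
  · obtain ⟨t₀, -, huniq⟩ := (hD.1 s).1.2 z hz
    exact (huniq t h).trans (huniq t' h').symm

/-- (M·U): existence -/
theorem exists_mem_t (hD : D.Valid) (s : Fin 11) {z : Fin 13} (hz : z ≠ 0) : ∃ t, D.mem s t z = true := by
  obtain ⟨t, ht, -⟩ := (hD.1 s).1.2 z hz
  exact ⟨t, ht⟩

/-- (U·U): existence -/
theorem exists_internal (hD : D.Valid) (s : Fin 11) {δ : Fin 13} (hδ : δ ≠ 0) : ∃ t x, D.mem s t x = true ∧ D.mem s t (x - δ) = true := by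
  obtain ⟨t, x, h1, h2, -⟩ := (hD.1 s).2 δ hδ
  exact ⟨t, x, h1, h2⟩

/-- (U·U): uniqueness -/
theorem internal_unique (hD : D.Valid) (s : Fin 11) {δ : Fin 13} (hδ : δ ≠ 0) {t t' : Fin 11} {x x' : Fin 13} (h1 : D.mem s t x = true)
    (h2 : D.mem s t (x - δ) = true) (h1' : D.mem s t' x' = true) (h2' : D.mem s t' (x' - δ) = true) : t = t' ∧ x = x' := by
  obtain ⟨t₀, x₀, -, -, huniq⟩ := (hD.1 s).2 δ hδ
  obtain ⟨e1, e2⟩ := huniq t x h1 h2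
  obtain ⟨e1', e2'⟩ := huniq t' x' h1' h2'
  exact ⟨e1.trans e1'.symm, e2.trans e2'.symm⟩

/-- (U·U′): columnwise disjointness -/
theorem cross_disjoint (hD : D.Valid) {s s' : Fin 11} (hss' : s ≠ s') (t : Fin 11) (z : Fin 13) : ¬ (D.mem s t z = true ∧ D.mem s' t z = true) :=
  (hD.2 s s' hss').1 t z

/-- (U·U′): existence -/
theorem exists_cross (hD : D.Valid) {s s' : Fin 11} (hss' : s ≠ s') {δ : Fin 13} (hδ : δ ≠ 0) :
    ∃ t x, D.mem s t x = true ∧ D.mem s' t (x - δ) = true := by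
  obtain ⟨t, x, h1, h2, -⟩ := (hD.2 s s' hss').2 δ hδ
  exact ⟨t, x, h1, h2⟩

/-- (U·U′): uniqueness -/
theorem cross_unique (hD : D.Valid) {s s' : Fin 11} (hss' : s ≠ s') {δ : Fin 13} (hδ : δ ≠ 0) {t t' : Fin 11} {x x' : Fin 13}
    (h1 : D.mem s t x = true) (h2 : D.mem s' t (x - δ) = true) (h1' : D.mem s t' x' = true) (h2' : D.mem s' t' (x' - δ) = true) :
    t = t' ∧ x = x' := by
  obtain ⟨t₀, x₀, -, -, huniq⟩ := (hD.2 s s' hss').2 δ hδ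
  obtain ⟨e1, e2⟩ := huniq t x h1 h2
  obtain ⟨e1', e2'⟩ := huniq t' x' h1' h2'
  exact ⟨e1.trans e1'.symm, e2.trans e2'.symm⟩

/-! ### Two distinct lines meet in exactly one point -/

/-- **existence of the meet** -/
theorem exists_meet (hD : D.Valid) (l₁ l₂ : TLn D) (hne : l₁ ≠ l₂) : ∃ p : TPt D, p ∈ l₁ ∧ p ∈ l₂ := by
  rcases l₁ with _ | x | ⟨s, y⟩ <;> rcases l₂ with _ | x' | ⟨s', y'⟩
  · exact absurd rfl hne
  · exact ⟨TPt.ax x', by simp, by simp⟩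
  · exact ⟨TPt.ax y', by simp, by simp⟩
  · exact ⟨TPt.ax x, by simp, by simp⟩
  · exact ⟨TPt.ctr, by simp, by simp⟩
  · by_cases hxy : x = y'
    · exact ⟨TPt.ax x, by simp, by simp [hxy]⟩
    · obtain ⟨t, ht⟩ := exists_mem_t hD s' (z := x - y') (sub_ne_zero.2 hxy)
      exact ⟨TPt.fr t x, by simp, by simpa using ht⟩
  · exact ⟨TPt.ax y, by simp, by simp⟩
  · by_cases hxy : x' = y
    · exact ⟨TPt.ax x', by simp [hxy], by simp⟩
    · obtain ⟨t, ht⟩ := exists_mem_t hD s (z := x' - y) (sub_ne_zero.2 hxy)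
      exact ⟨TPt.fr t x', by simpa using ht, by simp⟩
  · by_cases hss' : s = s'
    · subst hss'
      have hyy' : y' - y ≠ 0 := fun h => hne (by rw [sub_eq_zero.1 h])
      obtain ⟨t, z, h1, h2⟩ := exists_internal hD s hyy'
      refine ⟨TPt.fr t (z + y), ?_, ?_⟩
      · simpa using h1
      · rw [fr_mem_fl]; convert h2 using 2; abel
    · by_cases hyy : y = y'
      · subst hyy; exact ⟨TPt.ax y, by simp, by simp⟩
      · have hyy' : y' - y ≠ 0 := fun h => hyy (sub_eq_zero.1 h).symm
        obtain ⟨t, z, h1, h2⟩ := exists_cross hD hss' hyy'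
        refine ⟨TPt.fr t (z + y), ?_, ?_⟩
        · simpa using h1
        · rw [fr_mem_fl]; convert h2 using 2; abel

/-- **uniqueness of the meet** -/
theorem meet_unique (hD : D.Valid) {l₁ l₂ : TLn D} (hne : l₁ ≠ l₂) {p₁ p₂ : TPt D} (h1 : p₁ ∈ l₁) (h2 : p₂ ∈ l₁) (h3 : p₁ ∈ l₂) (h4 : p₂ ∈ l₂) :
    p₁ = p₂ := by
  rcases l₁ with _ | x | ⟨s, y⟩ <;> rcases l₂ with _ | x' | ⟨s', y'⟩
  · exact absurd rfl hne
  · -- axis ∩ pen x' = {ax x'}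
    rcases p₁ with _ | a | ⟨t, a⟩ <;> rcases p₂ with _ | b | ⟨u, b⟩ <;>
      simp only [ctr_mem_axis, ax_mem_axis, ax_mem_pen, fr_mem_axis] at h1 h2 h3 h4
    subst h3; subst h4; rfl
  · -- axis ∩ fl s' y' = {ax y'}
    rcases p₁ with _ | a | ⟨t, a⟩ <;> rcases p₂ with _ | b | ⟨u, b⟩ <;>
      simp only [ctr_mem_axis, ax_mem_axis, ax_mem_fl, fr_mem_axis] at h1 h2 h3 h4
    subst h3; subst h4; rfl
  · -- pen x ∩ axis = {ax x}
    rcases p₁ with _ | a | ⟨t, a⟩ <;> rcases p₂ with _ | b | ⟨u, b⟩ <;>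
      simp only [ctr_mem_axis, ax_mem_axis, ax_mem_pen, fr_mem_axis] at h1 h2 h3 h4
    subst h1; subst h2; rfl
  · -- pen x ∩ pen x' = {ctr}
    have hxx' : x ≠ x' := fun e => hne (by rw [e])
    rcases p₁ with _ | a | ⟨t, a⟩ <;> rcases p₂ with _ | b | ⟨u, b⟩ <;>
      simp only [ctr_mem_pen, ax_mem_pen, fr_mem_pen] at h1 h2 h3 h4
    all_goals first | rfl | exact absurd (h1.symm.trans h3) hxx' | exact absurd (h2.symm.trans h4) hxx'
  · -- pen x ∩ fl s' y'
    rcases p₁ with _ | a | ⟨t, a⟩ <;> rcases p₂ with _ | b | ⟨u, b⟩ <;>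
      simp only [ctr_mem_pen, ctr_mem_fl, ax_mem_pen, ax_mem_fl, fr_mem_pen, fr_mem_fl] at h1 h2 h3 h4
    · subst h3; subst h4; rfl
    · subst h1; subst h2; subst h3; rw [sub_self, mem_zero hD] at h4; exact absurd h4 (by simp)
    · subst h1; subst h2; subst h4; rw [sub_self, mem_zero hD] at h3; exact absurd h3 (by simp)
    · subst h1; subst h2; rw [mem_unique_t hD h3 h4]
  · -- fl s y ∩ axis = {ax y}
    rcases p₁ with _ | a | ⟨t, a⟩ <;> rcases p₂ with _ | b | ⟨u, b⟩ <;>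
      simp only [ctr_mem_axis, ax_mem_axis, ax_mem_fl, fr_mem_axis] at h1 h2 h3 h4
    subst h1; subst h2; rfl
  · -- fl s y ∩ pen x'
    rcases p₁ with _ | a | ⟨t, a⟩ <;> rcases p₂ with _ | b | ⟨u, b⟩ <;>
      simp only [ctr_mem_fl, ax_mem_pen, ax_mem_fl, fr_mem_pen, fr_mem_fl] at h1 h2 h3 h4
    · subst h1; subst h2; rfl
    · subst h1; subst h3; subst h4; rw [sub_self, mem_zero hD] at h2; exact absurd h2 (by simp)
    · subst h2; subst h3; subst h4; rw [sub_self, mem_zero hD] at h1; exact absurd h1 (by simp)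
    · subst h3; subst h4; rw [mem_unique_t hD h1 h2]
  · -- fl s y ∩ fl s' y'
    rcases p₁ with _ | a | ⟨t, a⟩ <;> rcases p₂ with _ | b | ⟨u, b⟩ <;>
      simp only [ctr_mem_fl, ax_mem_fl, fr_mem_fl] at h1 h2 h3 h4
    · subst h1; subst h2; rfl
    · subst h1; subst h3
      by_cases hss' : s = s'
      · subst hss'; exact absurd rfl hne
      · exact absurd ⟨h2, h4⟩ (cross_disjoint hD hss' u _)
    · subst h2; subst h4
      by_cases hss' : s = s'
      · subst hss'; exact absurd rfl hne
      · exact absurd ⟨h1, h3⟩ (cross_disjoint hD hss' t _)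
    · by_cases hss' : s = s'
      · subst hss'
        have hyy' : y' - y ≠ 0 := fun h => hne (by rw [sub_eq_zero.1 h])
        have e3 : D.mem s t (a - y - (y' - y)) = true := by convert h3 using 2; abel
        have e4 : D.mem s u (b - y - (y' - y)) = true := by convert h4 using 2; abel
        obtain ⟨e1, e2⟩ := internal_unique hD s hyy' h1 e3 h2 e4
        subst e1; have := sub_left_injective e2; subst this; rfl
      · by_cases hyy : y = y'
        · subst hyy; exact absurd ⟨h1, h3⟩ (cross_disjoint hD hss' t _)
        · have hyy' : y' - y ≠ 0 := fun h => hyy (sub_eq_zero.1 h).symm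
          have e3 : D.mem s' t (a - y - (y' - y)) = true := by convert h3 using 2; abel
          have e4 : D.mem s' u (b - y - (y' - y)) = true := by convert h4 using 2; abel
          obtain ⟨e1, e2⟩ := cross_unique hD hss' hyy' h1 e3 h2 e4
          subst e1; have := sub_left_injective e2; subst this; rfl

end Valid

/-! ### Finiteness and the plane -/

/-- points as a sum type -/
def TPt.equivSum : TPt D ≃ Unit ⊕ Fin 13 ⊕ (Fin 11 × Fin 13) where
  toFun p := match p with | .ctr => Sum.inl () | .ax x => Sum.inr (Sum.inl x) | .fr t x => Sum.inr (Sum.inr (t, x))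
  invFun q := match q with | Sum.inl _ => .ctr | Sum.inr (Sum.inl x) => .ax x | Sum.inr (Sum.inr (t, x)) => .fr t x
  left_inv := by rintro (_ | x | ⟨t, x⟩) <;> rfl
  right_inv := by rintro (⟨⟩ | x | ⟨t, x⟩) <;> rfl

/-- lines as a sum type -/
def TLn.equivSum : TLn D ≃ Unit ⊕ Fin 13 ⊕ (Fin 11 × Fin 13) where
  toFun m := match m with | .axis => Sum.inl () | .pen x => Sum.inr (Sum.inl x) | .fl s y => Sum.inr (Sum.inr (s, y))
  invFun q := match q with | Sum.inl _ => .axis | Sum.inr (Sum.inl x) => .pen x | Sum.inr (Sum.inr (s, y)) => .fl s y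
  left_inv := by rintro (_ | x | ⟨s, y⟩) <;> rfl
  right_inv := by rintro (⟨⟩ | x | ⟨s, y⟩) <;> rfl

/-- finitely many points -/
instance : Fintype (TPt D) := Fintype.ofEquiv _ TPt.equivSum.symm
/-- finitely many lines -/
instance : Fintype (TLn D) := Fintype.ofEquiv _ TLn.equivSum.symm

/-- as many points as lines -/
theorem card_TPt_eq_card_TLn : Fintype.card (TPt D) = Fintype.card (TLn D) := by
  rw [Fintype.card_congr (TPt.equivSum (D := D)), Fintype.card_congr (TLn.equivSum (D := D))]

/-- any two lines meet (and the structure is nondegenerate) -/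
@[reducible] noncomputable def liftHasPoints (hD : D.Valid) : HasPoints (TPt D) (TLn D) where
  exists_point := by
    rintro (_ | x | ⟨s, y⟩)
    · exact ⟨TPt.ctr, by simp⟩
    · exact ⟨TPt.ax (x + 1), by simp⟩
    · exact ⟨TPt.ctr, by simp⟩
  exists_line := by
    rintro (_ | x | ⟨t, x⟩)
    · exact ⟨TLn.axis, by simp⟩
    · exact ⟨TLn.pen (x + 1), by simp⟩
    · exact ⟨TLn.axis, by simp⟩
  eq_or_eq := fun {p₁ p₂ l₁ l₂} h1 h2 h3 h4 => by
    by_cases hl : l₁ = l₂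
    · exact Or.inr hl
    · exact Or.inl (meet_unique hD hl h1 h2 h3 h4)
  mkPoint := fun {l₁ l₂} h => Classical.choose (exists_meet hD l₁ l₂ h)
  mkPoint_ax := fun {l₁ l₂} h => Classical.choose_spec (exists_meet hD l₁ l₂ h)

/-- **The plane built from valid lift data.** -/
@[reducible] noncomputable def liftPlane13 (hD : D.Valid) : ProjectivePlane (TPt D) (TLn D) :=
  let hP : HasPoints (TPt D) (TLn D) := liftHasPoints hD
  let hL : HasLines (TPt D) (TLn D) := @HasPoints.hasLines _ _ _ hP _ _ card_TPt_eq_card_TLn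
  { hP, hL with
    exists_config := ⟨TPt.ax 2, TPt.ctr, TPt.fr 0 0, TLn.axis, TLn.pen 0, TLn.pen 1, by simp, by simp, by simp, by simp, by simp, by simp,
      by simp, by simp⟩ }

/-- the axis carries exactly the 13 points `ax x` -/
theorem natCard_mem_axis : Nat.card {p : TPt D // p ∈ (TLn.axis : TLn D)} = 13 := by
  let e : {p : TPt D // p ∈ (TLn.axis : TLn D)} ≃ Fin 13 :=
    { toFun := fun p => match p with | ⟨.ax x, _⟩ => x | ⟨.ctr, h⟩ => (h : False).elim | ⟨.fr _ _, h⟩ => (h : False).elim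
      invFun := fun x => ⟨.ax x, by simp⟩
      left_inv := by rintro ⟨_ | x | ⟨t, x⟩, h⟩ <;> first | rfl | exact (h : False).elim
      right_inv := fun x => rfl }
  rw [Nat.card_congr e, Nat.card_eq_fintype_card, Fintype.card_fin]

/-- **The plane has order 12.** -/
theorem order_liftPlane13 (hD : D.Valid) : @ProjectivePlane.order (TPt D) (TLn D) _ (liftPlane13 hD) = 12 := by
  letI := liftPlane13 hD
  have h : Nat.card {p : TPt D // p ∈ (TLn.axis : TLn D)} = ProjectivePlane.order (TPt D) (TLn D) + 1 :=
    ProjectivePlane.pointCount_eq (TPt D) (TLn.axis : TLn D)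
  rw [natCard_mem_axis] at h
  omega

/-! ### The shift collineation of order 13 -/

/-- shift on points -/
def shiftPt : TPt D → TPt D
  | .ctr => .ctr | .ax x => .ax (x + 1) | .fr t x => .fr t (x + 1)
/-- inverse shift on points -/
def unshiftPt : TPt D → TPt D
  | .ctr => .ctr | .ax x => .ax (x - 1) | .fr t x => .fr t (x - 1)
/-- shift on lines -/
def shiftLn : TLn D → TLn D
  | .axis => .axis | .pen x => .pen (x + 1) | .fl s y => .fl s (y + 1)
/-- inverse shift on lines -/
def unshiftLn : TLn D → TLn D
  | .axis => .axis | .pen x => .pen (x - 1) | .fl s y => .fl s (y - 1)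

/-- **the shift is a collineation** -/
def shift : Collineation (TPt D) (TLn D) where
  onPoints := ⟨shiftPt, unshiftPt, by rintro (_ | x | ⟨t, x⟩) <;> simp [shiftPt, unshiftPt],
    by rintro (_ | x | ⟨t, x⟩) <;> simp [shiftPt, unshiftPt]⟩
  onLines := ⟨shiftLn, unshiftLn, by rintro (_ | x | ⟨s, y⟩) <;> simp [shiftLn, unshiftLn],
    by rintro (_ | x | ⟨s, y⟩) <;> simp [shiftLn, unshiftLn]⟩
  mem_iff := by
    rintro (_ | x | ⟨t, x⟩) (_ | x' | ⟨s, y⟩) <;> simp [shiftPt, shiftLn, add_sub_add_right_eq_sub]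

/-- powers of the shift on free points -/
theorem shift_pow_fr (k : ℕ) (t : Fin 11) (x : Fin 13) :
    ((shift : Collineation (TPt D) (TLn D)).onPoints ^ k) (TPt.fr t x) = TPt.fr t (x + k • (1 : Fin 13)) := by
  induction k with
  | zero => simp
  | succ k ih =>
    rw [pow_succ', Equiv.Perm.mul_apply, ih]
    show TPt.fr t (x + k • (1 : Fin 13) + 1) = _
    rw [succ_nsmul, add_assoc]

/-- powers of the shift on axis points -/
theorem shift_pow_ax (k : ℕ) (x : Fin 13) :
    ((shift : Collineation (TPt D) (TLn D)).onPoints ^ k) (TPt.ax x) = TPt.ax (x + k • (1 : Fin 13)) := by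
  induction k with
  | zero => simp
  | succ k ih =>
    rw [pow_succ', Equiv.Perm.mul_apply, ih]
    show TPt.ax (x + k • (1 : Fin 13) + 1) = _
    rw [succ_nsmul, add_assoc]

/-- `shift¹³ = 1` -/
theorem shift_pow_thirteen : (shift : Collineation (TPt D) (TLn D)).onPoints ^ 13 = 1 := by
  ext p
  rcases p with _ | x | ⟨t, x⟩
  · rw [Equiv.Perm.pow_apply_eq_self_of_apply_eq_self (rfl : shift.onPoints (TPt.ctr : TPt D) = _)]; rfl
  · rw [shift_pow_ax, show (13 • (1 : Fin 13)) = 0 from by decide, add_zero]; rfl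
  · rw [shift_pow_fr, show (13 • (1 : Fin 13)) = 0 from by decide, add_zero]; rfl

/-- `shift ≠ 1` -/
theorem shift_ne_one : (shift : Collineation (TPt D) (TLn D)).onPoints ≠ 1 := by
  intro h
  have h' := congrArg (fun τ : Equiv.Perm (TPt D) => τ (TPt.ax 0)) h
  have h'' : (TPt.ax (0 + 1) : TPt D) = TPt.ax 0 := h'
  simp at h''

end Lift13

open Lift13 in
/-- **HIT route / exactness:** valid lift data give a projective plane of order 12 with a collineation `σ ≠ 1`, `σ¹³ = 1`. -/
theorem exists_plane_of_liftData13 (D : LiftData 11 13) (hD : D.Valid) :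
    ∃ (P L : Type) (_ : Membership P L) (_ : Fintype P) (_ : Fintype L) (_ : ProjectivePlane P L),
      ProjectivePlane.order P L = 12 ∧ ∃ σ : Collineation P L, σ.onPoints ^ 13 = 1 ∧ σ.onPoints ≠ 1 :=
  ⟨TPt D, TLn D, inferInstance, inferInstance, inferInstance, liftPlane13 hD, order_liftPlane13 hD, shift, shift_pow_thirteen, shift_ne_one⟩

/-- **The converse reduction: `NoOrderThirteenOrder12 → NoLiftData13`.** -/
theorem noLiftData13_of_noOrderThirteen (h : NoOrderThirteenOrder12) : NoLiftData13 := by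
  intro D hD
  obtain ⟨P, L, i1, i2, i3, i4, h12, σ, hq, hne⟩ := exists_plane_of_liftData13 D hD
  exact hne (h P L h12 σ hq)

/-- **The census statement of the order-13 cell is exact: `NoLiftData13 ↔ NoOrderThirteenOrder12`.** -/
theorem noLiftData13_iff : NoLiftData13 ↔ NoOrderThirteenOrder12 :=
  ⟨noOrderThirteen_of_noLiftData13, noLiftData13_of_noOrderThirteen⟩

end Summit.Ventures.DiscreteObjects.PP12
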